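import Summits.HodgeConjecture.HodgeConjecture.Theorems.Ring2DeformAnchoredFamilies
import Summits.HodgeConjecture.HodgeConjecture.Theorems.Ring2TransportWeilTypeExactness
import Literature.AlgebraicGeometry.HodgeTheory.AbelianVarietyPullbackAlgebraicClasses
import Literature.AlgebraicGeometry.Andre1996.CompactPencilReduction
import Literature.AlgebraicGeometry.Andre1996.WeilClassesAlgebraicallyAnchoredPencil
import HarnessLib

/-!
# Ring 2 · deform axis, part XI — product-charted sub-pencils: descent to a factor and pull-back of flat classes

HONEST FRAMING (cell `pub-hodge-ring2`, verbatim): research route conditional on HC_CM; not a corollary;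
Q11.4-sentence-2 already refuted in dim ≥ 3.

`HC_CM` := `Theses.RankFourFaces.CMAbelianHodge` (stmt-HodgeConjecture-3052) is a HYPOTHESIS `(hCM : …)` in the two
theorems of §2 (c) / §3 (d) where it occurs, never a cited fact; `HC_AV` := `Theses.PadicSemiregularLift.HodgeAbelianVarieties`
(stmt-HodgeConjecture-1333); the item served is stmt-HodgeConjecture-16267 (`Theses.RankFourFaces.CMToAbelian`), as a
helper. No definition, no new `@[conjecture]` node, no `sorry`.

WHAT THIS PART ADDS (RING2-MAP `## §deform (gen 14)` D.49, answer to `## §LEAD (gen 6)` L6.5 (3)). The cell lead's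
finding K3-WP (`pub-hodge-ring2-typer1/k3pull/K3-WEIL-PULLBACK.md`, two engines) places the four exceptional classes of a
K3-partner sixfold `X = Y × Z` on an EIGHTFOLD `B' = X × Z = Y × Z²` of Weil type for the quartic CM field `E`, as
pull-backs `(id_Y × Δ_Z)^* W_E(B')` of its Weil classes. On the deformation axis `B'` sits on TWO families: the
`(E, 4, δ)` Weil component (relative dimension 8, base of dimension 8) and, inside it, the DECOMPOSABLE SUB-PENCIL
`{Y_λ × Z²}` = the Mumford–Tate curve of `B'` (= that of `X`, since `MT(Y × Z²) = MT(Y × Z)`), whose CM fibres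
`Y₀ × Z² ~ B⁴` (`B` a simple CM surface) are free anchors modulo Tankeev–Ribet exactly as the fibres `Y₀ × Z ~ B³` of
part X. The kernel content of that picture is charts of a fibre by a PRODUCT `A × Z` and what they transmit to the
factor `A`:

§1 `hodgeConjectureFor_of_chart_prod_fiber`: a fibre charted by `(A × Z).X` at which HC holds gives HC for `A`
   (iso transport `Hypotheses.hodgeConjectureFor_iff_of_iso` + product descent `Ring2Transport.hodgeConjectureFor_of_prod`);
   twice for `(A × Z) × Z'`.
§2 On a smooth projective family satisfying (1.1) (`InvariantCyclesHoldFor f n`, a PREDICATE) with a product-charted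
   HODGE-GENERIC fibre `(A × Z).X ≅ 𝒳_s` (`HodgeClassesExtendAt f n s`), HC holds for the factor `A` as soon as `f` has
   an anchor: (a) any anchor; (b) a `B^{N+1}`-charted fibre, `B` simple of prime dimension (modulo Tankeev–Ribet, binder
   `h`), with the K3-partner sub-pencil shape `X₀ ~ (Y₀ × Z) × Z`, `Y₀ ~ B × B`, `Z ~ B` (`= B.powSucc 3` definitionally up
   to the isogeny calculus `IsIsogenous.prod`); (c) a CM-charted fibre under `HC_CM` (the ONLY place `HC_CM` enters §2).
§3 PER-CLASS PULL-BACK FORM (no Hodge-genericity needed — the shape of the K3-WP route): on an anchored (1.1)-family every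
   fibrewise rational `(p,p)` GLOBAL class `W` is algebraic at every fibre (typer 2's
   `forall_mem_algebraicClasses_of_invariantCycles_of_anchor`), hence so is its pull-back `g^*(e^*(W|_{𝒳_s}))` along any
   chart `e : A.X ≅ 𝒳_s` by an abelian variety and any morphism `g : X ⟶ A.X` from a smooth projective `X` (Fulton
   Cor. 19.2 (b) on abelian targets, tree theorem `map_mem_algebraicClasses_of_abelianVariety`). Anchors: (a) any;
   (b) `B^{N+1}` modulo Tankeev–Ribet; (c) `E^{N+1}`, `E` a CM elliptic curve — NO named fact (the `E_{k₁}⁸` points of the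
   Weil component at `E` biquadratic); (d) a CM chart under `HC_CM`; (e) ANDRÉ-ANCHORED (rev. 2, D.49 (Q2)): the
   Literature predicate `Andre1996.IsAlgebraicallyAnchoredPencilFor B p w f d` — André 1996 Lemme 6.3.3's compact pencil
   for a split Weil structure, through an isogenous copy of `B` and a fibre isogenous to a power of an elliptic curve,
   the anchor's algebraicity being part of the THEOREM in print — plus transport along that ONE pencil makes `g^* w`
   algebraic on any smooth projective `X ⟶ B.X`: no `HC_CM`, no Tankeev–Ribet, no chart hypothesis
   (`map_mem_algebraicClasses_of_algebraicallyAnchoredPencil_of_invariantCycles`, and the `IsCompactAbelianPencil`-quantified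
   form `…_compactPencils`); (f) THE NAMED FACT (rev. 2, gen 15): the literature seat's refereed Literature fact
   `Andre1996.andre1996_splitWeilClasses_algebraicallyAnchoredPencil` (André 1996 Lemme 6.3.3 ALONE, binder `h63`)
   DISCHARGES (e)'s pencil from typed split-Weil data on the member (`Deligne1982.IsWeilTypeCM B η R e₀ p`, an
   `E`-compatible hyperplane class, `Motives.IsHyperbolicWeilType`, a rational Weil class `w ∈ weilClassesField`,
   `p > 1`): `w` is algebraic on `B`, and `g^* w` on any smooth projective `X ⟶ B.X`, from (1.1) on the compact
   pencils algebraically anchored for `(B, w)` ONLY (`mem_algebraicClasses_of_splitWeil_of_andre1996_of_invariantCycles_anchored`,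
   `map_mem_algebraicClasses_of_splitWeil_of_andre1996_of_invariantCycles_anchored`) — no `HC_CM`, no Tankeev–Ribet, no CM
   hypothesis on `B`, no chart; with (1.1) on ALL compact abelian pencils of relative dimension `dim B` (and `p ≥ 1`)
   it is the literature seat's `andre1996_splitWeilClasses_algebraicallyAnchoredPencil.map_mem_algebraicClasses` itself.

What this does NOT say: that any family satisfies (1.1) (OPEN: node (CS) / `CompactAbelianPencilVHC` of parts I/IV up to
the anchor); that a given fibre is Hodge-generic (on the sub-pencil it is, at every non-CM fibre, by RING2-MAP D.46 (ii) —
an INFERENCE recorded there, not a kernel statement); that `(id × Δ)^*` of the Weil classes are the K3-partner classes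
(K3-WP: a cell computation with a hand proof, not in the tree); which CM points lie on which family (D.41/D.49, binders
`e₀`/`hiso` here). Nothing here decides `HC_CM`, `HC_AV`, any Weil component or any atlas cell.

Sources: [Abdulali 1994, (1.1) p. 1122 and Lemma 6.2 p. 1131]; [Deligne 1982, §4 (Weil type), §6 Prop. 6.1];
[Charles–Schnell 2014 = arXiv:1101.3647, Prop. 11.3.5, Thm. 11.5.11]; [Fulton 1998, §10.1 Ex. 10.1.2 (product descent),
§19.2 Cor. 19.2 (b) (pull-back of cycle classes)]; [Moonen–Zarhin 1999 = arXiv:math/9901113, §2 (2.7), §4 (one isogeny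
class of simple CM surfaces for a cyclic quartic CM field, arXiv p. 8)]; [van Geemen 1994, LNM 1594, Thm. 4.3 (powers of a
CM elliptic curve)]; [André 1996, §6.3 Lemme 6.3.1 (the shape "compact pencil + one good fibre"; proof p. 32: Baily–Borel boundary of
codimension ≥ 2 + Bertini), Lemme 6.3.3 p. 33 (split Weil classes: pencil with a fibre isogenous to a power of an elliptic
curve, [KuM91] §2), Remarque 2 p. 33].
-/

set_option linter.dupNamespace false

noncomputable section

namespace Summit.HodgeConjecture.HodgeConjecture.Ring2.Deform

open CategoryTheory AlgebraicGeometry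
open Literature.AlgebraicGeometry Literature.AlgebraicGeometry.Motives
open Literature.AlgebraicGeometry.HodgeTheory
open Literature.AlgebraicTopology.SingularHomology
open Literature.AlgebraicGeometry.Abdulali1994 (InvariantCyclesHoldFor)
open Literature.AlgebraicGeometry.Milne1999 (IsOfCMType)
open Summit.HodgeConjecture.HodgeConjecture
open Summit.HodgeConjecture.HodgeConjecture.Ring2Transport (hodgeConjectureFor_of_prod)
open Summit.HodgeConjecture.HodgeConjecture.Ring2.Hypotheses (anchorLocus mem_anchorLocus_of_chart
  hodgeConjectureFor_iff_of_iso HodgeClassesExtendAt forall_mem_algebraicClasses_of_invariantCycles_of_anchor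
  hodgeConjectureFor_fiber_of_invariantCycles_of_anchor_of_extend cmLocus_subset_anchorLocus_of_HC_CM)

variable {𝒳 S : SchemeOver ℂ}

/-! ## §1 — Descent from a product-charted fibre to a factor -/

/-- **A fibre charted by `A × Z` at which HC holds gives HC for `A`** (iso transport + `HC(A × Z) ⇒ HC(A)`).
[cite: Fulton1998, §10.1 Example 10.1.2] [cite: VoisinHodgeI2002, §11.3] -/
theorem hodgeConjectureFor_of_chart_prod_fiber {f : 𝒳 ⟶ S} {n : ℕ} {s : ComplexPoints S} (A Z : AbelianVariety ℂ)
    (e : (A.prod Z).X ≅ fiberOver f s) (hdim : (A.prod Z).dim = n) (h : HodgeConjectureFor n (fiberOver f s)) :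
    HodgeConjectureFor A.dim A.X := by
  subst hdim
  exact hodgeConjectureFor_of_prod A Z ((hodgeConjectureFor_iff_of_iso e).2 h)

/-- … twice: a fibre charted by `(A × Z) × Z'` (the eightfold `Y × Z × Z` over the sixfold `A = Y × Z` is the case
`A := Y × Z`, one step; this is the two-step form for a fourfold factor). [cite: Fulton1998, §10.1 Example 10.1.2] -/
theorem hodgeConjectureFor_of_chart_prod_prod_fiber {f : 𝒳 ⟶ S} {n : ℕ} {s : ComplexPoints S}
    (A Z Z' : AbelianVariety ℂ) (e : ((A.prod Z).prod Z').X ≅ fiberOver f s) (hdim : ((A.prod Z).prod Z').dim = n)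
    (h : HodgeConjectureFor n (fiberOver f s)) : HodgeConjectureFor A.dim A.X :=
  hodgeConjectureFor_of_prod A Z (hodgeConjectureFor_of_chart_prod_fiber (A.prod Z) Z' e hdim h)

/-! ## §2 — Product-charted Hodge-generic fibres of anchored (1.1)-families: HC for the factor -/

/-- **(a) any anchor.** (1.1) on `f`, an anchor fibre, and a Hodge-generic fibre charted by `A × Z` give HC for `A`.
[cite: Abdulali1994FamiliesAV, (1.1) (p. 1122) and Lemma 6.2 (p. 1131)] [cite: CharlesSchnell2014Notes, Prop. 11.3.5] -/
theorem hodgeConjectureFor_factor_of_invariantCycles_of_anchor_of_chart_prod_of_extend {f : 𝒳 ⟶ S} {n : ℕ}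
    (hf : IsSmoothProjectiveFamily f n) (hIC : InvariantCyclesHoldFor f n) (hanc : (anchorLocus f n).Nonempty)
    {s : ComplexPoints S} (A Z : AbelianVariety ℂ) (e : (A.prod Z).X ≅ fiberOver f s) (hdim : (A.prod Z).dim = n)
    (hgen : HodgeClassesExtendAt f n s) : HodgeConjectureFor A.dim A.X :=
  hodgeConjectureFor_of_chart_prod_fiber A Z e hdim
    (hodgeConjectureFor_fiber_of_invariantCycles_of_anchor_of_extend hf hIC hanc hgen)

/-- **(b) anchor `A₀ ~ B^{N+1}`, `B` simple of prime dimension (modulo Tankeev–Ribet; no `HC_CM`).** The decomposable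
sub-pencil `{Y_λ × Z²}` of the `(E, 4, δ)` Weil component at `E` cyclic (or `D₄` of `L`-type): `p = 2`, `N = 3`,
`A = Y_λ × Z`. [cite: MoonenZarhin1999LowDim, §2 Thm. (2.7)] [cite: Abdulali1994FamiliesAV, Lemma 6.2 (p. 1131)] -/
theorem hodgeConjectureFor_factor_of_invariantCycles_of_chart_simplePrimeDim_of_tankeevRibet_of_chart_prod_of_extend
    (h : TankeevRibet1983_hodgeClasses_divisorial_powers_simplePrimeDimension) {f : 𝒳 ⟶ S} {n : ℕ}
    (hf : IsSmoothProjectiveFamily f n) (hIC : InvariantCyclesHoldFor f n) {s₀ : ComplexPoints S}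
    (A₀ : AbelianVariety ℂ) (e₀ : A₀.X ≅ fiberOver f s₀) (hdim₀ : A₀.dim = n) (B : AbelianVariety ℂ) {p : ℕ}
    (hp : p.Prime) (hB : B.dim = p) (hs : B.IsSimple) (N : ℕ) (hiso : A₀.IsIsogenous (B.powSucc N))
    {s : ComplexPoints S} (A Z : AbelianVariety ℂ) (e : (A.prod Z).X ≅ fiberOver f s) (hdim : (A.prod Z).dim = n)
    (hgen : HodgeClassesExtendAt f n s) : HodgeConjectureFor A.dim A.X :=
  hodgeConjectureFor_of_chart_prod_fiber A Z e hdim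
    (hodgeConjectureFor_fiber_of_invariantCycles_of_chart_simplePrimeDim_of_tankeevRibet_of_extend h hf hIC A₀ e₀
      hdim₀ B hp hB hs N hiso hgen)

/-- **(b′) the K3-partner sub-pencil in the shape D.49 supplies it**: anchor fibre `X₀ ~ (Y₀ × Z) × Z` with `Y₀ ~ B × B`,
`Z ~ B`, `B` a simple abelian surface (so `X₀ ~ B.powSucc 3`), Hodge-generic fibre `(A × Z).X ≅ 𝒳_s` with `A = Y_λ × Z`
the K3-partner sixfold: (1.1) on the sub-pencil gives HC for `Y_λ × Z` — modulo Tankeev–Ribet, no `HC_CM`.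
[cite: MoonenZarhin1999LowDim, §2 Thm. (2.7) and §4 (quartic-CM-field dichotomy, arXiv p. 8)]
[cite: Abdulali1994FamiliesAV, Lemma 6.2 (p. 1131)] [cite: CharlesSchnell2014Notes, Thm. 11.5.11 (a)–(c)] -/
theorem hodgeConjectureFor_factor_of_invariantCycles_of_chart_prod_sq_prod_of_tankeevRibet_of_chart_prod_of_extend
    (h : TankeevRibet1983_hodgeClasses_divisorial_powers_simplePrimeDimension) {f : 𝒳 ⟶ S} {n : ℕ}
    (hf : IsSmoothProjectiveFamily f n) (hIC : InvariantCyclesHoldFor f n) {s₀ : ComplexPoints S}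
    (X₀ : AbelianVariety ℂ) (e₀ : X₀.X ≅ fiberOver f s₀) (hdim₀ : X₀.dim = n) (B : AbelianVariety ℂ) (hB : B.dim = 2)
    (hs : B.IsSimple) {Y₀ Z : AbelianVariety ℂ} (hX : X₀.IsIsogenous ((Y₀.prod Z).prod Z))
    (hY : Y₀.IsIsogenous (B.prod B)) (hZ : Z.IsIsogenous B) {s : ComplexPoints S} (A : AbelianVariety ℂ)
    (e : (A.prod Z).X ≅ fiberOver f s) (hdim : (A.prod Z).dim = n) (hgen : HodgeClassesExtendAt f n s) :
    HodgeConjectureFor A.dim A.X :=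
  hodgeConjectureFor_factor_of_invariantCycles_of_chart_simplePrimeDim_of_tankeevRibet_of_chart_prod_of_extend h hf hIC
    X₀ e₀ hdim₀ B Nat.prime_two hB hs 3 (hX.trans ((hY.prod hZ).prod hZ)) A Z e hdim hgen

/-- **(c) a CM-charted anchor under `HC_CM`** (the only way `HC_CM` enters §2: `cmLocus f n ⊆ anchorLocus f n`). The
`D₄`, non-`L`-type members on their own Mumford–Tate curve (CM fibres `(B₁ × B₂) × Z²`, no free fibre on the curve).
[cite: Milne1999, §7 p. 72 (hypothesis (H))] [cite: Abdulali1994FamiliesAV, proof of Lemma 6.2 (p. 1131)] -/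
theorem hodgeConjectureFor_factor_of_HC_CM_of_invariantCycles_of_cmChart_of_chart_prod_of_extend
    (hCM : Theses.RankFourFaces.CMAbelianHodge) {f : 𝒳 ⟶ S} {n : ℕ} (hf : IsSmoothProjectiveFamily f n)
    (hIC : InvariantCyclesHoldFor f n) {s₀ : ComplexPoints S} (A₀ : AbelianVariety ℂ) (e₀ : A₀.X ≅ fiberOver f s₀)
    (hdim₀ : A₀.dim = n) (hcm : IsOfCMType A₀) {s : ComplexPoints S} (A Z : AbelianVariety ℂ)
    (e : (A.prod Z).X ≅ fiberOver f s) (hdim : (A.prod Z).dim = n) (hgen : HodgeClassesExtendAt f n s) :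
    HodgeConjectureFor A.dim A.X :=
  hodgeConjectureFor_factor_of_invariantCycles_of_anchor_of_chart_prod_of_extend hf hIC
    ⟨s₀, cmLocus_subset_anchorLocus_of_HC_CM hCM f n ⟨A₀, ⟨e₀⟩, hdim₀, hcm⟩⟩ A Z e hdim hgen

/-! ## §3 — Per-class pull-back form: flat Hodge classes of an anchored (1.1)-family pulled back along a chart and a morphism -/

/-- **(a) any anchor.** On a family satisfying (1.1) with an anchor fibre, every fibrewise rational `(p,p)` global class
`W` restricts to an ALGEBRAIC class on every fibre; transported along a chart `e : A.X ≅ 𝒳_s` by an abelian variety and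
pulled back along any morphism `g : X ⟶ A.X` from a smooth projective `X` it stays algebraic. No Hodge-genericity of
`𝒳_s` is needed (the K3-WP shape: `A = Y × Z²`, `g = id_Y × Δ_Z`, `W` = the flat Weil sections).
[cite: Abdulali1994FamiliesAV, (1.1) (p. 1122)] [cite: Fulton1998, §19.2 Cor. 19.2 (b) and Appendix B.9.2 (a)] -/
theorem map_mem_algebraicClasses_of_invariantCycles_of_anchor_of_chart {f : 𝒳 ⟶ S} {n : ℕ}
    (hIC : InvariantCyclesHoldFor f n) (hanc : (anchorLocus f n).Nonempty) {s : ComplexPoints S}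
    (A : AbelianVariety ℂ) (e : A.X ≅ fiberOver f s) {m : ℕ} {X : SchemeOver ℂ} (hX : IsSmoothProjective m X)
    (g : X ⟶ A.X) {p : ℕ} (W : complexBetti 𝒳 (2 * p))
    (hW : ∀ t : ComplexPoints S, IsRationalClass (complexBetti.map (fiberι f t) (2 * p) W) ∧
      IsOfHodgeType n (fiberOver f t) (2 * p) p p (complexBetti.map (fiberι f t) (2 * p) W)) :
    complexBetti.map g (2 * p) (complexBetti.map e.hom (2 * p) (complexBetti.map (fiberι f s) (2 * p) W)) ∈
      algebraicClasses X p := by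
  obtain ⟨s₀, hs₀⟩ := hanc
  exact map_mem_algebraicClasses_of_abelianVariety hX A g
    ((mem_algebraicClasses_map_iff_of_iso e).2
      (forall_mem_algebraicClasses_of_invariantCycles_of_anchor hIC hs₀ W hW s))

/-- **(b) anchor `A₀ ~ B^{N+1}`, `B` simple of prime dimension (modulo Tankeev–Ribet; no `HC_CM`)** — the `~ B_Φ⁴` CM
points (`B_Φ` a simple CM surface with CM by `E`) of the `(E, 4, δ)` Weil component, `E` cyclic or of type `D₄`.
[cite: MoonenZarhin1999LowDim, §2 Thm. (2.7)] [cite: Fulton1998, §19.2 Cor. 19.2 (b)] -/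
theorem map_mem_algebraicClasses_of_invariantCycles_of_chart_simplePrimeDim_of_tankeevRibet_of_chart
    (h : TankeevRibet1983_hodgeClasses_divisorial_powers_simplePrimeDimension) {f : 𝒳 ⟶ S} {n : ℕ}
    (hIC : InvariantCyclesHoldFor f n) {s₀ : ComplexPoints S} (A₀ : AbelianVariety ℂ) (e₀ : A₀.X ≅ fiberOver f s₀)
    (hdim₀ : A₀.dim = n) (B : AbelianVariety ℂ) {q : ℕ} (hq : q.Prime) (hB : B.dim = q) (hs : B.IsSimple) (N : ℕ)
    (hiso : A₀.IsIsogenous (B.powSucc N)) {s : ComplexPoints S} (A : AbelianVariety ℂ) (e : A.X ≅ fiberOver f s)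
    {m : ℕ} {X : SchemeOver ℂ} (hX : IsSmoothProjective m X) (g : X ⟶ A.X) {p : ℕ} (W : complexBetti 𝒳 (2 * p))
    (hW : ∀ t : ComplexPoints S, IsRationalClass (complexBetti.map (fiberι f t) (2 * p) W) ∧
      IsOfHodgeType n (fiberOver f t) (2 * p) p p (complexBetti.map (fiberι f t) (2 * p) W)) :
    complexBetti.map g (2 * p) (complexBetti.map e.hom (2 * p) (complexBetti.map (fiberι f s) (2 * p) W)) ∈
      algebraicClasses X p :=
  map_mem_algebraicClasses_of_invariantCycles_of_anchor_of_chart hIC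
    ⟨s₀, mem_anchorLocus_of_chart e₀
      (hdim₀ ▸ hodgeConjectureFor_of_isIsogenous_powSucc_simplePrimeDim_of_tankeevRibet h B hq hB hs N hiso)⟩
    A e hX g W hW

section CMEllipticPowers

variable {E : AbelianVariety ℂ} (hE : E.dim = 1) (φ : E ⟶ E) {d : ℕ} (hd : 0 < d) (hφ : φ ≫ φ = -(d • 𝟙 E))
include hE hd hφ

/-- **(c) anchor `A₀ ~ E^{N+1}`, `E` an elliptic curve with complex multiplication — NO named fact, no `HC_CM`** (the
`E_{k₁}⁸` points of the `(E, 4, δ)` Weil component at `E = k₁k₂` biquadratic).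
[cite: vanGeemen1994HodgeAV, Thm. 4.3] [cite: Fulton1998, §19.2 Cor. 19.2 (b)] -/
theorem map_mem_algebraicClasses_of_invariantCycles_of_chart_of_isIsogenous_powSucc_of_cm_of_chart {f : 𝒳 ⟶ S}
    {n : ℕ} (hIC : InvariantCyclesHoldFor f n) {s₀ : ComplexPoints S} (A₀ : AbelianVariety ℂ)
    (e₀ : A₀.X ≅ fiberOver f s₀) (hdim₀ : A₀.dim = n) (N : ℕ) (hiso : A₀.IsIsogenous (E.powSucc N))
    {s : ComplexPoints S} (A : AbelianVariety ℂ) (e : A.X ≅ fiberOver f s) {m : ℕ} {X : SchemeOver ℂ}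
    (hX : IsSmoothProjective m X) (g : X ⟶ A.X) {p : ℕ} (W : complexBetti 𝒳 (2 * p))
    (hW : ∀ t : ComplexPoints S, IsRationalClass (complexBetti.map (fiberι f t) (2 * p) W) ∧
      IsOfHodgeType n (fiberOver f t) (2 * p) p p (complexBetti.map (fiberι f t) (2 * p) W)) :
    complexBetti.map g (2 * p) (complexBetti.map e.hom (2 * p) (complexBetti.map (fiberι f s) (2 * p) W)) ∈
      algebraicClasses X p :=
  map_mem_algebraicClasses_of_invariantCycles_of_anchor_of_chart hIC
    ⟨s₀, Hypotheses.mem_anchorLocus_of_chart_of_isIsogenous_powSucc_of_cm A₀ e₀ hdim₀ hE φ hd hφ N hiso⟩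
    A e hX g W hW

end CMEllipticPowers

/-- **(d) a CM-charted anchor under `HC_CM`** (the CM points of a general Weil component; `HC_CM` an ARGUMENT).
[cite: Milne1999, §7 p. 72 (hypothesis (H))] [cite: Deligne1982HodgeCycles, §4 and §6 Prop. 6.1] -/
theorem map_mem_algebraicClasses_of_HC_CM_of_invariantCycles_of_cmChart_of_chart
    (hCM : Theses.RankFourFaces.CMAbelianHodge) {f : 𝒳 ⟶ S} {n : ℕ} (hIC : InvariantCyclesHoldFor f n)
    {s₀ : ComplexPoints S} (A₀ : AbelianVariety ℂ) (e₀ : A₀.X ≅ fiberOver f s₀) (hdim₀ : A₀.dim = n)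
    (hcm : IsOfCMType A₀) {s : ComplexPoints S} (A : AbelianVariety ℂ) (e : A.X ≅ fiberOver f s) {m : ℕ}
    {X : SchemeOver ℂ} (hX : IsSmoothProjective m X) (g : X ⟶ A.X) {p : ℕ} (W : complexBetti 𝒳 (2 * p))
    (hW : ∀ t : ComplexPoints S, IsRationalClass (complexBetti.map (fiberι f t) (2 * p) W) ∧
      IsOfHodgeType n (fiberOver f t) (2 * p) p p (complexBetti.map (fiberι f t) (2 * p) W)) :
    complexBetti.map g (2 * p) (complexBetti.map e.hom (2 * p) (complexBetti.map (fiberι f s) (2 * p) W)) ∈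
      algebraicClasses X p :=
  map_mem_algebraicClasses_of_invariantCycles_of_anchor_of_chart hIC
    ⟨s₀, cmLocus_subset_anchorLocus_of_HC_CM hCM f n ⟨A₀, ⟨e₀⟩, hdim₀, hcm⟩⟩ A e hX g W hW

/-! ## §3 (e) André's algebraically anchored pencils (Lemme 6.3.3 shape): no chart at the anchor

The transport habitat cut down to ONE compact pencil (RING2-MAP `## §deform (gen 14)` D.49 (Q2)).
André 1996, Lemme 6.3.3 (p. 33): for Weil classes `w ∈ ⋀^{2p}_E H¹(B)(p)`, `p > 1`, on an abelian
variety `B` whose `E`-hermitian form is split, there is a COMPACT pencil of abelian varieties through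
(an isogenous copy of) `B` and a fibre isogenous to a power of an elliptic curve, on which `w` extends
to a global flat section of Hodge classes, ALGEBRAIC at that fibre ([KuM91] §2) — the Literature
predicate `Andre1996.IsAlgebraicallyAnchoredPencilFor B p w f d` (a fibre chart `e₁ : A₁.X ≅ 𝒳_{s₁}`,
a homomorphism `B ⟶ A₁` pulling the section back to `q • w`, `q ≠ 0`, an algebraic anchor fibre), and
`IsAlgebraicallyAnchoredPencilFor.mem_algebraicClasses` proves `w` algebraic from transport of
algebraicity along that one pencil. Here it is pulled back along an ARBITRARY morphism `g : X ⟶ B.X`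
of smooth projective varieties (the K3-partner cell: `B = Y × Z × Z` the `E`-Weil eightfold, `w` a
Weil class, `X = Y × Z`, `g = id × Δ`; K3-WP — the `E`-structure of Weil type on `Z × Z` being the
twisted diagonal one for `E` cyclic, the `kᵢ ⊂ M₂(kᵢ)` one for `E = k₁k₂` biquadratic, and for `E` of
type `D₄` (`Z = Z_Y` with CM by the REFLEX field `Eʳ`) the anti-flag `E ⊗ Eʳ`-line, RING2-MAP §deform
(gen 15) D.52): NO `HC_CM`, NO Tankeev–Ribet, NO chart or genericity hypothesis at either end — the
anchor's algebraicity is part of André's THEOREM. André's Lemme 6.3.3 supplies the predicate for a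
SPLIT Weil structure (`p > 1`); reaching the split component by rescaling polarisations is free for
`E` cyclic or biquadratic and a norm condition for `E` of type `D₄` (D.52) — the predicate is a
HYPOTHESIS here either way.
[cite: Andre1996Motifs, Lemme 6.3.3 (p. 33) and Lemme 6.3.1 proof (p. 32: Baily–Borel boundary of
codimension ≥ 2, Bertini)] -/

/-- **(e) André-anchored**: an algebraically anchored compact pencil for `(B, w)` (André 1996 Lemme
6.3.3 shape, Literature predicate) + transport of algebraicity along it ⟹ `g^* w` is algebraic on
every smooth projective `X` mapping to `B`. Inputs: NONE beyond the two hypotheses (no `HC_CM`, no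
named fact). [cite: Andre1996Motifs, Lemme 6.3.3 (p. 33)] -/
theorem map_mem_algebraicClasses_of_algebraicallyAnchoredPencil_of_invariantCycles
    {B : AbelianVariety ℂ} {p : ℕ} {w : complexBetti B.X (2 * p)} {f : 𝒳 ⟶ S} {d : ℕ}
    (h : Andre1996.IsAlgebraicallyAnchoredPencilFor B p w f d) (hV : InvariantCyclesHoldFor f d)
    {m : ℕ} {X : SchemeOver ℂ} (hX : IsSmoothProjective m X) (g : X ⟶ B.X) :
    complexBetti.map g (2 * p) w ∈ algebraicClasses X p :=
  map_mem_algebraicClasses_of_abelianVariety hX B g (h.mem_algebraicClasses hV)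

/-- **(e′) the same with the variational input quantified André's way** ("(1.1) on every compact
pencil of abelian varieties", `Motives.IsCompactAbelianPencil`): one André pencil for `(B, w)` then
makes `g^* w` algebraic. [cite: Andre1996Motifs, §6.3 Remarque 2 (p. 33)] -/
theorem map_mem_algebraicClasses_of_algebraicallyAnchoredPencil_of_invariantCycles_compactPencils
    (hV : ∀ ⦃d : ℕ⦄ ⦃𝒳 S : SchemeOver ℂ⦄ (f : 𝒳 ⟶ S), IsCompactAbelianPencil f d →
      InvariantCyclesHoldFor f d)
    {B : AbelianVariety ℂ} {p : ℕ} {w : complexBetti B.X (2 * p)} {f : 𝒳 ⟶ S} {d : ℕ}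
    (h : Andre1996.IsAlgebraicallyAnchoredPencilFor B p w f d)
    {m : ℕ} {X : SchemeOver ℂ} (hX : IsSmoothProjective m X) (g : X ⟶ B.X) :
    complexBetti.map g (2 * p) w ∈ algebraicClasses X p :=
  map_mem_algebraicClasses_of_algebraicallyAnchoredPencil_of_invariantCycles h (hV f h.1) hX g

/-! ## §3 (f) The named fact: André 1996 Lemme 6.3.3 (Literature, refereed) discharges (e)'s pencil

The literature seat's `Andre1996.andre1996_splitWeilClasses_algebraicallyAnchoredPencil` renders
Lemme 6.3.3 alone: a SPLIT Weil structure relative to a CM field `E ≅ ℚ[T]/(R(T²))` on `B`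
(`Deligne1982.IsWeilTypeCM B η R e₀ p`, `dim_E H¹(B) = 2p`; an `E`-compatible hyperplane class
`h = e^* a` — the Rosati involution induces complex conjugation on `E`; `Motives.IsHyperbolicWeilType`
— André's condition (*), Deligne Cor. 4.2 (b)) and a rational Weil class `w`, `p > 1`, admit ONE
compact pencil of abelian varieties algebraically anchored for `(B, w)`. Composed with (e): the only
variational input is (1.1) on the pencils anchored for `(B, w)` — one pencil's worth — and nothing of
CM type enters (no `HC_CM`, no Tankeev–Ribet, no CM point). In the K3-partner cell `B = Y × Z²` is the
split member of RING2-MAP D.49/D.52 (for `E` of type `D₄`: on the split coset only), `p = 2`,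
`g = id × Δ`; the split-Weil data are HYPOTHESES on the member (K3-WP and the polarisation bookkeeping
are cell computations, not tree theorems). [cite: Andre1996Motifs, Lemme 6.3.3 (p. 33), §6.3 b) (*)
(p. 32), Remarque 2 (p. 33)] [cite: Deligne1982HodgeCycles, §4 Cor. 4.2, (4.8)] -/

section SplitWeilNamedFact

variable {B : AbelianVariety ℂ} {η : B ⟶ B} {R : Polynomial ℤ} {e₀ p : ℕ}
  {emb : ProjectiveEmbedding B.X} {a : complexBetti (Motives.projectiveSpace emb.n ℂ) 2}
  {w : complexBetti B.X (2 * p)}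

/-- **(f₀) the member**: Lemme 6.3.3 (named fact `h63`) + split Weil data on `B` + `p > 1` + (1.1)
on the compact pencils algebraically anchored for `(B, w)` ⟹ the rational Weil class `w` is
algebraic on `B`. No `HC_CM`, no Tankeev–Ribet, no CM hypothesis, no chart.
[cite: Andre1996Motifs, Lemme 6.3.3 (p. 33)] -/
theorem mem_algebraicClasses_of_splitWeil_of_andre1996_of_invariantCycles_anchored
    (h63 : Andre1996.andre1996_splitWeilClasses_algebraicallyAnchoredPencil)
    (hB : Deligne1982.IsWeilTypeCM B η R e₀ p) (hp : 1 < p) (ha : IsRationalClass a) (ha₀ : a ≠ 0)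
    (hRos : ∀ x y : complexBetti B.X 1,
      polarizationPairingOne B.X (complexBetti.map emb.ι 2 a) (B.dim - 1)
          (VanGeemen1994.pullbackOne B η x) y =
        -polarizationPairingOne B.X (complexBetti.map emb.ι 2 a) (B.dim - 1) x
          (VanGeemen1994.pullbackOne B η y))
    (hsplit : IsHyperbolicWeilType B η (p * e₀) (complexBetti.map emb.ι 2 a))
    (hw : w ∈ weilClassesField B η (R.comp (Polynomial.X ^ 2)) (2 * p)) (hwQ : IsRationalClass w)
    (hV : ∀ ⦃𝒳' S' : SchemeOver ℂ⦄ (f : 𝒳' ⟶ S'),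
      Andre1996.IsAlgebraicallyAnchoredPencilFor B p w f B.dim → InvariantCyclesHoldFor f B.dim) :
    w ∈ algebraicClasses B.X p := by
  obtain ⟨𝒳', S', f, hf⟩ := h63.single hB hp ha ha₀ hRos hsplit hw hwQ
  exact hf.mem_algebraicClasses (hV f hf)

/-- **(f) pulled back**: the same inputs make `g^* w` algebraic on every smooth projective `X`
mapping to `B` (the K3-partner cell: `X = Y × Z`, `g = id × Δ`, `w` a Weil class of the split
eightfold `Y × Z²`; K3-WP is not in the tree). With (1.1) on ALL compact abelian pencils of relative
dimension `dim B` (and any `p ≥ 1`) this is the literature seat's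
`andre1996_splitWeilClasses_algebraicallyAnchoredPencil.map_mem_algebraicClasses`; the point here is
the weaker variational binder. [cite: Andre1996Motifs, Lemme 6.3.3 and Remarque 2 (p. 33)] -/
theorem map_mem_algebraicClasses_of_splitWeil_of_andre1996_of_invariantCycles_anchored
    (h63 : Andre1996.andre1996_splitWeilClasses_algebraicallyAnchoredPencil)
    (hB : Deligne1982.IsWeilTypeCM B η R e₀ p) (hp : 1 < p) (ha : IsRationalClass a) (ha₀ : a ≠ 0)
    (hRos : ∀ x y : complexBetti B.X 1,
      polarizationPairingOne B.X (complexBetti.map emb.ι 2 a) (B.dim - 1)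
          (VanGeemen1994.pullbackOne B η x) y =
        -polarizationPairingOne B.X (complexBetti.map emb.ι 2 a) (B.dim - 1) x
          (VanGeemen1994.pullbackOne B η y))
    (hsplit : IsHyperbolicWeilType B η (p * e₀) (complexBetti.map emb.ι 2 a))
    (hw : w ∈ weilClassesField B η (R.comp (Polynomial.X ^ 2)) (2 * p)) (hwQ : IsRationalClass w)
    (hV : ∀ ⦃𝒳' S' : SchemeOver ℂ⦄ (f : 𝒳' ⟶ S'),
      Andre1996.IsAlgebraicallyAnchoredPencilFor B p w f B.dim → InvariantCyclesHoldFor f B.dim)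
    {m : ℕ} {X : SchemeOver ℂ} (hX : IsSmoothProjective m X) (g : X ⟶ B.X) :
    complexBetti.map g (2 * p) w ∈ algebraicClasses X p := by
  obtain ⟨𝒳', S', f, hf⟩ := h63.single hB hp ha ha₀ hRos hsplit hw hwQ
  exact map_mem_algebraicClasses_of_algebraicallyAnchoredPencil_of_invariantCycles hf (hV f hf) hX g

end SplitWeilNamedFact

end Summit.HodgeConjecture.HodgeConjecture.Ring2.Deform

end
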